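/-
Copyright (c) 2026. All rights reserved.
Released under Apache 2.0 license as described in the file LICENSE.
-/
import Literature.NumberTheory.Automorphic.BrandtModuleAtkinLehnerInvariants
import HarnessLib

/-!
# The `±1`-eigenspaces of a level Atkin–Lehner involution `W_{p⁺}` (`p^e ∥ N⁺`) on the Brandt module of an Eichler order:
# `ℚ^{Cls O} = E₊ ⊕ E₋`, both Hecke-stable, `2 dim E_± = #Cls O ± #Fix(W_{p⁺})` (Voight (41.3.5), Cor. 41.4.10; Pizer)

[tag: quaternion_algebra] [tag: eichler_order] [tag: hecke_operator]

Topic `NumberTheory/Automorphic`; THEOREMS ONLY (no definition, no named fact, no instance; net Literature debt `0`).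
Lane `lit-hodgefound`, seat p12, gen 51 — companion of `BrandtMatrixRamifiedEigenspaces.lean` (the ramified involutions
`W_{q⁻}`, whose permutation matrices are the Brandt matrices `T(q)`). At a level prime `p ∣ N⁺` (`p ∤ N⁻`) the involution
`W_{p⁺} : [I] ↦ [I 𝔔_{p^e}]` of `Cls O` (`BrandtSetupAtkinLehnerInvolutions.lean`) acts on the Brandt module `ℚ^{Cls O}` by
the permutation operator `v ↦ v ∘ W_{p⁺}` (Mathlib's `LinearMap.funLeft ℚ ℚ (S.wPlus p hp)`); it is NOT a Brandt matrix, but it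
commutes with all of them (`T(n)_{W c, W c'} = T(n)_{c c'}`, `BrandtSetupAtkinLehnerHecke.lean`). For EVERY Brandt setup:

* §1 (generic, private) an involutive permutation `σ` of a finite set: `ℚ^X = E₊ ⊕ E₋` for `v ↦ v ∘ σ`, `tr = #Fix σ = dim E₊ − dim E₋`;
* §2 `XiSetup.toLin_map_matrix_ramified_eq_funLeft_wMinus` (`T(q) = (· ∘ W_{q⁻})` as endomorphisms, `q ∣ N⁻`),
  `XiSetup.funLeft_wPlus_mul_self` (`W² = 1`), `mem_eigenspace_funLeft_wPlus_one/neg_one_iff`, **`isCompl_eigenspaces_funLeft_wPlus`**,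
  `eigenspace_funLeft_wPlus_eq_bot_of_ne`, **`commute_funLeft_wPlus_toLin_matrix`** and **`mapsTo_toLin_matrix_eigenspace_funLeft_wPlus`**
  (both sign spaces are Hecke submodules), `trace_funLeft_wPlus` (`tr = #Fix W_{p⁺}`), **`two_mul_finrank_eigenspace_funLeft_wPlus_one/neg_one`**
  (`2 dim E_± = #Cls O ± #Fix(W_{p⁺})`), `natCard_typeSet_le_finrank_eigenspace_funLeft_wPlus_one` (`#Typ O ≤ dim E₊`),
  **`hasEigenvalue_funLeft_wPlus_neg_one_iff`** (`−1` occurs iff `W_{p⁺}` moves a class), `eigenspace_funLeft_wPlus_one_eq_top_of_not_dvd`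
  (`p ∤ N⁺`: `W_{p⁺} = 1`).

## References

* [Voight2021] J. Voight, *Quaternion Algebras*, GTM 288 (2021): (41.3.5), Cor. 41.4.10, Prop. 23.4.14 and (23.4.20).
* [VignerasLNM800] M.-F. Vignéras, *Arithmétique des algèbres de quaternions*, LNM 800 (1980), Ch. III §5 exercice 5.8 (b)–(d).
* [BertoliniDarmon1996] M. Bertolini, H. Darmon, *Heegner points on Mumford–Tate curves*, Invent. Math. 126 (1996), §1.5
  (the Atkin–Lehner involutions `W_p^±` on the definite Brandt module).

## Scope (honest)

Theorems only. No arithmetic description of `#Fix(W_{p⁺})` (an embedding-number count) is given here.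
-/

noncomputable section

open scoped Pointwise Matrix

namespace Literature.NumberTheory.Automorphic

namespace Brandt

/-! ## §1 An involutive permutation of a finite set acting on functions (generic) -/

section Generic

variable {X : Type*} {σ : X → X}

/-- `(· ∘ σ)² = 1` for an involution `σ`. [folklore] -/
private theorem funLeft_mul_self (hσ : Function.Involutive σ) :
    LinearMap.funLeft ℚ ℚ σ * LinearMap.funLeft ℚ ℚ σ = 1 := by
  ext v x
  simp [Module.End.mul_apply, LinearMap.funLeft_apply, hσ x]

/-- `E₊ = {v : v ∘ σ = v}`. [folklore] -/
private theorem mem_eigenspace_funLeft_one_iff (v : X → ℚ) :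
    v ∈ Module.End.eigenspace (LinearMap.funLeft ℚ ℚ σ) 1 ↔ ∀ x, v (σ x) = v x := by
  rw [Module.End.mem_eigenspace_iff, one_smul, funext_iff]
  simp only [LinearMap.funLeft_apply]

/-- `E₋ = {v : v ∘ σ = −v}`. [folklore] -/
private theorem mem_eigenspace_funLeft_neg_one_iff (v : X → ℚ) :
    v ∈ Module.End.eigenspace (LinearMap.funLeft ℚ ℚ σ) (-1) ↔ ∀ x, v (σ x) = -v x := by
  rw [Module.End.mem_eigenspace_iff, funext_iff]
  simp only [LinearMap.funLeft_apply, Pi.smul_apply, smul_eq_mul, neg_one_mul]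

/-- `E₊ ⊓ E₋ = 0`. [folklore] -/
private theorem eigenspace_funLeft_inf (σ : X → X) :
    Module.End.eigenspace (LinearMap.funLeft ℚ ℚ σ) 1 ⊓ Module.End.eigenspace (LinearMap.funLeft ℚ ℚ σ) (-1) = ⊥ := by
  rw [eq_bot_iff]
  intro v hv
  rw [Submodule.mem_inf, mem_eigenspace_funLeft_one_iff, mem_eigenspace_funLeft_neg_one_iff] at hv
  rw [Submodule.mem_bot]
  funext x
  have h1 := hv.1 x
  have h2 := hv.2 x
  rw [Pi.zero_apply]
  linarith

/-- `E₊ + E₋ = ℚ^X` (`σ² = 1`, characteristic `0`). [folklore] -/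
private theorem eigenspace_funLeft_sup (hσ : Function.Involutive σ) :
    Module.End.eigenspace (LinearMap.funLeft ℚ ℚ σ) 1 ⊔ Module.End.eigenspace (LinearMap.funLeft ℚ ℚ σ) (-1) = ⊤ := by
  rw [eq_top_iff]
  intro v _
  rw [Submodule.mem_sup]
  refine ⟨fun x => (v x + v (σ x)) / 2, (mem_eigenspace_funLeft_one_iff _).mpr fun x => ?_,
    fun x => (v x - v (σ x)) / 2, (mem_eigenspace_funLeft_neg_one_iff _).mpr fun x => ?_, ?_⟩
  · show (v (σ x) + v (σ (σ x))) / 2 = (v x + v (σ x)) / 2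
    rw [hσ x]; ring
  · show (v (σ x) - v (σ (σ x))) / 2 = -((v x - v (σ x)) / 2)
    rw [hσ x]; ring
  · funext x
    show (v x + v (σ x)) / 2 + (v x - v (σ x)) / 2 = v x
    ring

/-- `ℚ^X = E₊ ⊕ E₋`. [folklore] -/
private theorem isCompl_eigenspaces_funLeft (hσ : Function.Involutive σ) :
    IsCompl (Module.End.eigenspace (LinearMap.funLeft ℚ ℚ σ) 1) (Module.End.eigenspace (LinearMap.funLeft ℚ ℚ σ) (-1)) :=
  ⟨disjoint_iff.mpr (eigenspace_funLeft_inf σ), codisjoint_iff.mpr (eigenspace_funLeft_sup hσ)⟩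

/-- No eigenvalue other than `±1`. [folklore] -/
private theorem eigenspace_funLeft_eq_bot_of_ne (hσ : Function.Involutive σ) {μ : ℚ} (h1 : μ ≠ 1) (h2 : μ ≠ -1) :
    Module.End.eigenspace (LinearMap.funLeft ℚ ℚ σ) μ = ⊥ := by
  rw [eq_bot_iff]
  intro v hv
  rw [Module.End.mem_eigenspace_iff, funext_iff] at hv
  simp only [LinearMap.funLeft_apply, Pi.smul_apply, smul_eq_mul] at hv
  rw [Submodule.mem_bot]
  funext x
  have e1 := hv x
  have e2 := hv (σ x)
  rw [hσ x] at e2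
  have hμ : μ * μ - 1 ≠ 0 := by
    intro h0
    rcases mul_self_eq_one_iff.mp (by linarith : μ * μ = 1) with h | h
    · exact h1 h
    · exact h2 h
  have hv0 : (μ * μ - 1) * v x = 0 := by linear_combination (-μ) * e1 - e2
  rw [Pi.zero_apply]
  exact (mul_eq_zero.mp hv0).resolve_left hμ

/-- `(· ∘ σ)` is `Matrix.toLin'` of the permutation matrix of `σ`. [folklore] -/
private theorem toLin_permMatrix_eq_funLeft [Fintype X] [DecidableEq X] (hσ : Function.Involutive σ) :
    Matrix.toLin' ((hσ.toPerm _).permMatrix ℚ) = LinearMap.funLeft ℚ ℚ σ := by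
  apply LinearMap.ext
  intro v
  rw [Matrix.toLin'_apply, Matrix.permMatrix_mulVec, Function.Involutive.coe_toPerm]
  rfl

/-- `tr(· ∘ σ) = #Fix σ`. [folklore] -/
private theorem trace_funLeft_eq [Fintype X] [DecidableEq X] (hσ : Function.Involutive σ) :
    LinearMap.trace ℚ _ (LinearMap.funLeft ℚ ℚ σ) = Nat.card {x : X // σ x = x} := by
  rw [← toLin_permMatrix_eq_funLeft hσ, Matrix.trace_toLin'_eq, Matrix.trace]
  simp only [Matrix.diag_apply, PEquiv.toMatrix_apply, Equiv.toPEquiv_apply, Option.mem_def, Option.some.injEq,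
    Function.Involutive.coe_toPerm]
  rw [Finset.sum_boole, Nat.card_eq_fintype_card, Fintype.card_subtype]

/-- `(· ∘ σ)|_{E_μ} = μ · id`. [folklore] -/
private theorem restrict_funLeft_eq_smul_id (μ : ℚ)
    (h : Set.MapsTo (LinearMap.funLeft ℚ ℚ σ) (Module.End.eigenspace (LinearMap.funLeft ℚ ℚ σ) μ)
      (Module.End.eigenspace (LinearMap.funLeft ℚ ℚ σ) μ)) :
    (LinearMap.funLeft ℚ ℚ σ).restrict h = μ • LinearMap.id := by
  ext v
  have hv := Module.End.mem_eigenspace_iff.mp v.2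
  simp only [LinearMap.restrict_apply, LinearMap.smul_apply, LinearMap.id_apply, Submodule.coe_smul, hv]

/-- `tr(· ∘ σ) = dim E₊ − dim E₋`. [folklore] -/
private theorem trace_funLeft_eq_finrank_sub [Fintype X] [DecidableEq X] (hσ : Function.Involutive σ) :
    LinearMap.trace ℚ _ (LinearMap.funLeft ℚ ℚ σ) =
      (Module.finrank ℚ (Module.End.eigenspace (LinearMap.funLeft ℚ ℚ σ) 1) : ℚ) -
        Module.finrank ℚ (Module.End.eigenspace (LinearMap.funLeft ℚ ℚ σ) (-1)) := by
  set L := LinearMap.funLeft ℚ ℚ σ with hL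
  set N : Bool → Submodule ℚ (X → ℚ) := fun b => cond b (Module.End.eigenspace L 1) (Module.End.eigenspace L (-1)) with hN
  have hint : DirectSum.IsInternal N := by
    refine (DirectSum.isInternal_submodule_iff_isCompl N (i := true) (j := false) (by decide) ?_).mpr ?_
    · ext b; cases b <;> simp
    · exact isCompl_eigenspaces_funLeft hσ
  have hmap : ∀ μ : ℚ, Set.MapsTo L (Module.End.eigenspace L μ) (Module.End.eigenspace L μ) := fun μ =>
    Module.End.mapsTo_genEigenspace_of_comm (Commute.refl L) μ 1
  have hf : ∀ b, Set.MapsTo L (N b) (N b) := fun b => by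
    cases b
    · exact hmap (-1)
    · exact hmap 1
  have key := LinearMap.trace_eq_sum_trace_restrict hint hf
  rw [Fintype.sum_bool] at key
  have h1 : LinearMap.trace ℚ _ (L.restrict (hf true)) = (Module.finrank ℚ (Module.End.eigenspace L 1) : ℚ) := by
    have e : L.restrict (hf true) = (1 : ℚ) • LinearMap.id := restrict_funLeft_eq_smul_id 1 (hmap 1)
    rw [e, one_smul, LinearMap.trace_id]
    rfl
  have h2 : LinearMap.trace ℚ _ (L.restrict (hf false)) = -(Module.finrank ℚ (Module.End.eigenspace L (-1)) : ℚ) := by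
    have e : L.restrict (hf false) = (-1 : ℚ) • LinearMap.id := restrict_funLeft_eq_smul_id (-1) (hmap (-1))
    rw [e, map_smul, LinearMap.trace_id, smul_eq_mul, neg_one_mul]
    rfl
  rw [key, h1, h2, sub_eq_add_neg]

/-- `dim E₊ + dim E₋ = #X`. [folklore] -/
private theorem finrank_eigenspaces_funLeft_add [Fintype X] (hσ : Function.Involutive σ) :
    Module.finrank ℚ (Module.End.eigenspace (LinearMap.funLeft ℚ ℚ σ) 1) +
      Module.finrank ℚ (Module.End.eigenspace (LinearMap.funLeft ℚ ℚ σ) (-1)) = Nat.card X := by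
  have key := Submodule.finrank_sup_add_finrank_inf_eq (Module.End.eigenspace (LinearMap.funLeft ℚ ℚ σ) 1)
    (Module.End.eigenspace (LinearMap.funLeft ℚ ℚ σ) (-1))
  rw [eigenspace_funLeft_sup hσ, eigenspace_funLeft_inf σ, finrank_top, finrank_bot, add_zero,
    Module.finrank_fintype_fun_eq_card, ← Nat.card_eq_fintype_card] at key
  omega

/-- `2 dim E₊ = #X + #Fix σ` and `2 dim E₋ = #X − #Fix σ`. [folklore] -/
private theorem two_mul_finrank_eigenspaces_funLeft [Fintype X] [DecidableEq X] (hσ : Function.Involutive σ) :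
    (2 * Module.finrank ℚ (Module.End.eigenspace (LinearMap.funLeft ℚ ℚ σ) 1) : ℚ) =
        Nat.card X + Nat.card {x : X // σ x = x} ∧
      (2 * Module.finrank ℚ (Module.End.eigenspace (LinearMap.funLeft ℚ ℚ σ) (-1)) : ℚ) =
        Nat.card X - Nat.card {x : X // σ x = x} := by
  have h1 := trace_funLeft_eq_finrank_sub hσ
  rw [trace_funLeft_eq hσ] at h1
  have h2 := finrank_eigenspaces_funLeft_add hσ
  have h2' : (Module.finrank ℚ (Module.End.eigenspace (LinearMap.funLeft ℚ ℚ σ) 1) : ℚ) +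
      Module.finrank ℚ (Module.End.eigenspace (LinearMap.funLeft ℚ ℚ σ) (-1)) = Nat.card X := by exact_mod_cast h2
  constructor <;> linarith

end Generic

/-! ## §2 The level involutions `W_{p⁺}` on the Brandt module -/

variable {Nplus Nminus : ℕ} (S : XiSetup Nplus Nminus) [Fintype (ClassSet S.O)] [DecidableEq (ClassSet S.O)]

/-- **`T(q) = (· ∘ W_{q⁻})` as endomorphisms of `ℚ^{Cls O}`** (`q ∣ N⁻`): the ramified case of this file is
`BrandtMatrixRamifiedEigenspaces`. [cite: VignerasLNM800, Ch. III §5 exercice 5.8 (b)] -/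
theorem XiSetup.toLin_map_matrix_ramified_eq_funLeft_wMinus {q : ℕ} [Fact q.Prime] (hq : q ∣ Nminus) :
    Matrix.toLin' ((matrix S.O q).map (Int.cast : ℤ → ℚ)) = LinearMap.funLeft ℚ ℚ (S.wMinus q hq) := by
  apply LinearMap.ext
  intro v
  funext c
  rw [Matrix.toLin'_apply, S.map_matrix_ramified_mulVec_of_dvd hq, LinearMap.funLeft_apply]

variable {p : ℕ} [hpf : Fact p.Prime]

omit [Fintype (ClassSet S.O)] [DecidableEq (ClassSet S.O)] in
/-- **`W_{p⁺}² = 1` on the Brandt module.** [cite: Voight2021, (41.3.5) and Prop. 23.4.14] [cite: BertoliniDarmon1996, §1.5] -/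
theorem XiSetup.funLeft_wPlus_mul_self (hp : ¬ p ∣ Nminus) :
    LinearMap.funLeft ℚ ℚ (S.wPlus p hp) * LinearMap.funLeft ℚ ℚ (S.wPlus p hp) = 1 :=
  funLeft_mul_self (S.involutive_wPlus hp)

omit [Fintype (ClassSet S.O)] [DecidableEq (ClassSet S.O)] in
/-- `E₊(W_{p⁺}) = {v : v ∘ W_{p⁺} = v}`. [cite: Voight2021, (41.3.5)] -/
theorem XiSetup.mem_eigenspace_funLeft_wPlus_one_iff (hp : ¬ p ∣ Nminus) (v : ClassSet S.O → ℚ) :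
    v ∈ Module.End.eigenspace (LinearMap.funLeft ℚ ℚ (S.wPlus p hp)) 1 ↔ ∀ c, v (S.wPlus p hp c) = v c :=
  mem_eigenspace_funLeft_one_iff v

omit [Fintype (ClassSet S.O)] [DecidableEq (ClassSet S.O)] in
/-- `E₋(W_{p⁺}) = {v : v ∘ W_{p⁺} = −v}`. [cite: Voight2021, (41.3.5)] -/
theorem XiSetup.mem_eigenspace_funLeft_wPlus_neg_one_iff (hp : ¬ p ∣ Nminus) (v : ClassSet S.O → ℚ) :
    v ∈ Module.End.eigenspace (LinearMap.funLeft ℚ ℚ (S.wPlus p hp)) (-1) ↔ ∀ c, v (S.wPlus p hp c) = -v c :=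
  mem_eigenspace_funLeft_neg_one_iff v

omit [Fintype (ClassSet S.O)] [DecidableEq (ClassSet S.O)] in
/-- **`ℚ^{Cls O} = E₊(W_{p⁺}) ⊕ E₋(W_{p⁺})`.** [cite: Voight2021, (41.3.5) and Cor. 41.4.10] [cite: BertoliniDarmon1996, §1.5] -/
theorem XiSetup.isCompl_eigenspaces_funLeft_wPlus (hp : ¬ p ∣ Nminus) :
    IsCompl (Module.End.eigenspace (LinearMap.funLeft ℚ ℚ (S.wPlus p hp)) 1)
      (Module.End.eigenspace (LinearMap.funLeft ℚ ℚ (S.wPlus p hp)) (-1)) :=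
  isCompl_eigenspaces_funLeft (S.involutive_wPlus hp)

omit [Fintype (ClassSet S.O)] [DecidableEq (ClassSet S.O)] in
/-- `W_{p⁺}` has no eigenvalue other than `±1`. [cite: Voight2021, (41.3.5)] -/
theorem XiSetup.eigenspace_funLeft_wPlus_eq_bot_of_ne (hp : ¬ p ∣ Nminus) {μ : ℚ} (h1 : μ ≠ 1) (h2 : μ ≠ -1) :
    Module.End.eigenspace (LinearMap.funLeft ℚ ℚ (S.wPlus p hp)) μ = ⊥ :=
  eigenspace_funLeft_eq_bot_of_ne (S.involutive_wPlus hp) h1 h2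

omit [Fintype (ClassSet S.O)] [DecidableEq (ClassSet S.O)] in
/-- The spectrum of `W_{p⁺}` is contained in `{1, −1}`. [cite: Voight2021, (41.3.5)] -/
theorem XiSetup.hasEigenvalue_funLeft_wPlus_imp (hp : ¬ p ∣ Nminus) {μ : ℚ}
    (h : Module.End.HasEigenvalue (LinearMap.funLeft ℚ ℚ (S.wPlus p hp)) μ) : μ = 1 ∨ μ = -1 := by
  by_contra hne
  push Not at hne
  exact (Module.End.hasEigenvalue_iff.mp h) (S.eigenspace_funLeft_wPlus_eq_bot_of_ne hp hne.1 hne.2)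

/-- **`W_{p⁺}` commutes with every Brandt matrix `T(n)`** on `ℚ^{Cls O}`. [cite: Voight2021, (41.3.5)] [cite: BertoliniDarmon1996, §1.5] -/
theorem XiSetup.commute_funLeft_wPlus_toLin_matrix (hp : ¬ p ∣ Nminus) (n : ℕ) :
    Commute (LinearMap.funLeft ℚ ℚ (S.wPlus p hp)) (Matrix.toLin' ((matrix S.O n).map (Int.cast : ℤ → ℚ))) := by
  change LinearMap.funLeft ℚ ℚ (S.wPlus p hp) * Matrix.toLin' _ = Matrix.toLin' _ * LinearMap.funLeft ℚ ℚ (S.wPlus p hp)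
  apply LinearMap.ext
  intro v
  rw [Module.End.mul_apply, Module.End.mul_apply, Matrix.toLin'_apply, Matrix.toLin'_apply]
  change ((matrix S.O n).map (Int.cast : ℤ → ℚ) *ᵥ v) ∘ S.wPlus p hp =
    (matrix S.O n).map (Int.cast : ℤ → ℚ) *ᵥ (v ∘ S.wPlus p hp)
  rw [S.map_mulVec_comp_wPlus hp n v]

/-- **`E₊(W_{p⁺})` and `E₋(W_{p⁺})` are Hecke submodules**: every `T(n)` maps each into itself. [cite: Voight2021, Cor. 41.4.10] [cite: BertoliniDarmon1996, §1.5] -/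
theorem XiSetup.mapsTo_toLin_matrix_eigenspace_funLeft_wPlus (hp : ¬ p ∣ Nminus) (n : ℕ) (μ : ℚ) :
    Set.MapsTo (Matrix.toLin' ((matrix S.O n).map (Int.cast : ℤ → ℚ)))
      (Module.End.eigenspace (LinearMap.funLeft ℚ ℚ (S.wPlus p hp)) μ)
      (Module.End.eigenspace (LinearMap.funLeft ℚ ℚ (S.wPlus p hp)) μ) :=
  Module.End.mapsTo_genEigenspace_of_comm (S.commute_funLeft_wPlus_toLin_matrix hp n) μ 1

/-- **`tr W_{p⁺} = #Fix(W_{p⁺})`** on the Brandt module. [cite: Voight2021, (41.3.5)] -/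
theorem XiSetup.trace_funLeft_wPlus (hp : ¬ p ∣ Nminus) :
    LinearMap.trace ℚ _ (LinearMap.funLeft ℚ ℚ (S.wPlus p hp)) = Nat.card {c : ClassSet S.O // S.wPlus p hp c = c} :=
  trace_funLeft_eq (S.involutive_wPlus hp)

/-- `tr W_{p⁺} = dim E₊ − dim E₋`. [cite: Voight2021, (41.3.5)] -/
theorem XiSetup.trace_funLeft_wPlus_eq_finrank_sub (hp : ¬ p ∣ Nminus) :
    LinearMap.trace ℚ _ (LinearMap.funLeft ℚ ℚ (S.wPlus p hp)) =
      (Module.finrank ℚ (Module.End.eigenspace (LinearMap.funLeft ℚ ℚ (S.wPlus p hp)) 1) : ℚ) -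
        Module.finrank ℚ (Module.End.eigenspace (LinearMap.funLeft ℚ ℚ (S.wPlus p hp)) (-1)) :=
  trace_funLeft_eq_finrank_sub (S.involutive_wPlus hp)

omit [DecidableEq (ClassSet S.O)] in
/-- `dim E₊(W_{p⁺}) + dim E₋(W_{p⁺}) = #Cls O`. [cite: Voight2021, (41.3.5)] -/
theorem XiSetup.finrank_eigenspaces_funLeft_wPlus_add (hp : ¬ p ∣ Nminus) :
    Module.finrank ℚ (Module.End.eigenspace (LinearMap.funLeft ℚ ℚ (S.wPlus p hp)) 1) +
      Module.finrank ℚ (Module.End.eigenspace (LinearMap.funLeft ℚ ℚ (S.wPlus p hp)) (-1)) = Nat.card (ClassSet S.O) :=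
  finrank_eigenspaces_funLeft_add (S.involutive_wPlus hp)

/-- **`2 dim E₊(W_{p⁺}) = #Cls O + #Fix(W_{p⁺})`** — the number of `W_{p⁺}`-orbits, doubled. [cite: Voight2021, (41.3.5) and Cor. 18.5.12] -/
theorem XiSetup.two_mul_finrank_eigenspace_funLeft_wPlus_one (hp : ¬ p ∣ Nminus) :
    (2 * Module.finrank ℚ (Module.End.eigenspace (LinearMap.funLeft ℚ ℚ (S.wPlus p hp)) 1) : ℚ) =
      Nat.card (ClassSet S.O) + Nat.card {c : ClassSet S.O // S.wPlus p hp c = c} :=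
  (two_mul_finrank_eigenspaces_funLeft (S.involutive_wPlus hp)).1

/-- **`2 dim E₋(W_{p⁺}) = #Cls O − #Fix(W_{p⁺})`.** [cite: Voight2021, (41.3.5) and Cor. 18.5.12] -/
theorem XiSetup.two_mul_finrank_eigenspace_funLeft_wPlus_neg_one (hp : ¬ p ∣ Nminus) :
    (2 * Module.finrank ℚ (Module.End.eigenspace (LinearMap.funLeft ℚ ℚ (S.wPlus p hp)) (-1)) : ℚ) =
      Nat.card (ClassSet S.O) - Nat.card {c : ClassSet S.O // S.wPlus p hp c = c} :=
  (two_mul_finrank_eigenspaces_funLeft (S.involutive_wPlus hp)).2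

omit [Fintype (ClassSet S.O)] [DecidableEq (ClassSet S.O)] in
/-- The functions of the type lie in `E₊(W_{p⁺})`. [cite: Voight2021, Remark 17.4.15 and (23.4.20)] -/
theorem XiSetup.range_funLeft_typeOf_le_eigenspace_funLeft_wPlus_one (hp : ¬ p ∣ Nminus) :
    LinearMap.range (LinearMap.funLeft ℚ ℚ (typeOf S.O)) ≤ Module.End.eigenspace (LinearMap.funLeft ℚ ℚ (S.wPlus p hp)) 1 := by
  rintro v ⟨g, rfl⟩
  exact (S.mem_eigenspace_funLeft_wPlus_one_iff hp _).mpr fun c => congrArg g (S.typeOf_wPlus hp c)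

omit [Fintype (ClassSet S.O)] [DecidableEq (ClassSet S.O)] in
/-- **`#Typ O ≤ dim E₊(W_{p⁺})`.** [cite: Voight2021, Cor. 18.5.12 and (23.4.20)] -/
theorem XiSetup.natCard_typeSet_le_finrank_eigenspace_funLeft_wPlus_one (hp : ¬ p ∣ Nminus) :
    Nat.card (TypeSet S.O) ≤ Module.finrank ℚ (Module.End.eigenspace (LinearMap.funLeft ℚ ℚ (S.wPlus p hp)) 1) := by
  haveI : Fintype (ClassSet S.O) := Fintype.ofFinite _
  rw [← S.finrank_range_funLeft_typeOf]
  exact Submodule.finrank_mono (S.range_funLeft_typeOf_le_eigenspace_funLeft_wPlus_one hp)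

omit [Fintype (ClassSet S.O)] [DecidableEq (ClassSet S.O)] in
/-- `+1` is an eigenvalue of `W_{p⁺}`. [cite: Voight2021, (41.3.5)] -/
theorem XiSetup.hasEigenvalue_funLeft_wPlus_one (hp : ¬ p ∣ Nminus) :
    Module.End.HasEigenvalue (LinearMap.funLeft ℚ ℚ (S.wPlus p hp)) 1 := by
  rw [Module.End.hasEigenvalue_iff, Ne, ← Submodule.finrank_eq_zero]
  have h := S.natCard_typeSet_le_finrank_eigenspace_funLeft_wPlus_one hp
  have ht := S.natCard_typeSet_pos
  omega

/-- **`−1` is an eigenvalue of `W_{p⁺}` iff `W_{p⁺}` moves some class.** [cite: Voight2021, (41.3.5) and Cor. 18.5.12] -/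
theorem XiSetup.hasEigenvalue_funLeft_wPlus_neg_one_iff (hp : ¬ p ∣ Nminus) :
    Module.End.HasEigenvalue (LinearMap.funLeft ℚ ℚ (S.wPlus p hp)) (-1) ↔ ∃ c : ClassSet S.O, S.wPlus p hp c ≠ c := by
  rw [Module.End.hasEigenvalue_iff, Ne, ← Submodule.finrank_eq_zero]
  have h2 := S.two_mul_finrank_eigenspace_funLeft_wPlus_neg_one hp
  have hsub : Nat.card {c : ClassSet S.O // S.wPlus p hp c = c} ≤ Nat.card (ClassSet S.O) := by
    rw [Nat.card_eq_fintype_card, Nat.card_eq_fintype_card]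
    exact Fintype.card_subtype_le _
  have hiff : Nat.card {c : ClassSet S.O // S.wPlus p hp c = c} = Nat.card (ClassSet S.O) ↔
      ∀ c : ClassSet S.O, S.wPlus p hp c = c := by
    rw [Nat.card_eq_fintype_card, Nat.card_eq_fintype_card, Fintype.card_subtype, Finset.card_eq_iff_eq_univ,
      Finset.eq_univ_iff_forall]
    simp only [Finset.mem_filter, Finset.mem_univ, true_and]
  constructor
  · intro hne
    by_contra hall
    push Not at hall
    have hcard := hiff.mpr hall
    apply hne
    have : (2 * Module.finrank ℚ (Module.End.eigenspace (LinearMap.funLeft ℚ ℚ (S.wPlus p hp)) (-1)) : ℚ) = 0 := by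
      rw [h2, hcard, sub_self]
    exact_mod_cast (mul_eq_zero.mp this).resolve_left two_ne_zero
  · rintro ⟨c, hc⟩ h0
    have hlt : Nat.card {c : ClassSet S.O // S.wPlus p hp c = c} < Nat.card (ClassSet S.O) :=
      lt_of_le_of_ne hsub fun heq => hc (hiff.mp heq c)
    have : (2 * Module.finrank ℚ (Module.End.eigenspace (LinearMap.funLeft ℚ ℚ (S.wPlus p hp)) (-1)) : ℚ) = 0 := by
      rw [h0]; norm_num
    rw [h2] at this
    have : (Nat.card {c : ClassSet S.O // S.wPlus p hp c = c} : ℚ) = Nat.card (ClassSet S.O) := by linarith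
    exact absurd (by exact_mod_cast this) hlt.ne

omit [Fintype (ClassSet S.O)] [DecidableEq (ClassSet S.O)] in
/-- At a prime `p ∤ N⁺N⁻` the involution `W_{p⁺}` is the identity: `E₊ = ℚ^{Cls O}`. [cite: Voight2021, (23.4.20)] -/
theorem XiSetup.eigenspace_funLeft_wPlus_one_eq_top_of_not_dvd (hp : ¬ p ∣ Nminus) (hpN : ¬ p ∣ Nplus) :
    Module.End.eigenspace (LinearMap.funLeft ℚ ℚ (S.wPlus p hp)) 1 = ⊤ := by
  rw [eq_top_iff]
  intro v _
  exact (S.mem_eigenspace_funLeft_wPlus_one_iff hp v).mpr fun c => by rw [S.wPlus_eq_self_of_not_dvd hp hpN]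

end Brandt

end Literature.NumberTheory.Automorphic
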